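import Summits.CriticalPhenomena.PercolationContinuityZ3.Theorems.PercNearOneGluingNoHeavyLowerTailKnQuestion8PocketAssembly
import HarnessLib

/-!
# Kozma–Nitzan's Question 8 / MC-D for three relays — FUNCTIONAL assembly: the pocket-designated (GΨ₃^D) for every monotone cluster
# property from PCOV (x-side, y-side) and (Z*D)

Support file (`--supports stmt-CriticalPhenomena-4575`, closed), prover `prim-lf-2` (gen 16).  No definitions, no named facts, no sorries;
standard axioms.  Companion of `…KnQuestion8PocketAssembly.lean` (`PocketCert.block41_three_of_pcov`, the case `F = 1{b ∈ ·}` = (41)); memo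
`prim-lf-2/POCKET-CERT-gen16.md`.  For a monotone cluster property `F`, a pocket family `𝒟` (down-closed, avoiding `x, y, z`; `P = {C_o ∈ 𝒟}`), the
certificate point `(t, λ, μ)` and the three inputs at `F` —
  PCOV_x : `b0·(mDE1·∫_{P∩Fx} F(C x) − mDFx·∫_{P∩E1x} F(C x)) ≤ mDE2·((mDE1+mDFx)·(∫_{W1} F(C x) + ∫_{W3} F(C x)) − (a+d)·(∫_{P∩E1x} F(C x) + ∫_{P∩Fx} F(C x)))`,
  PCOV_y : the mirror, (Z*D) : `∫_{J'} F(C z) ≤ λ ∫_{P∩{x↮z}} F(C z) + μ ∫_{P∩{y↮z}} F(C z)` —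
and the pocket comparisons `∫_P F(C z) ≤ ∫_P F(C x), ∫_P F(C y)`:
* `PocketCert.gpsi_three_pocket_of_pcov` — `∫_{o↔x ∪ o↔y} F(C z) ≤ ∫_{o↔x ∪ o↔y} F(C o)` (the conclusion of (GΨ₃^D); prim-lf-2's functional MC-D@3,
  0 / 97 300 LP-feasible instances).  Chain: `attach_of_pocket` → `p1star_pocket_of_pieces` → `opart_of_pocketHalves` → `gpsi_three_pocket_of_dom`.
[cite: KozmaNitzan2024, Questions 8–9 (§5.5 p. 36), Conjecture 4 and §5.1 (pp. 31–32)] [cite: VandenbergHaggstromKahn2005, Thm. 2.1 (p. 9)]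
-/

namespace Summit.CriticalPhenomena.PercolationContinuityZ3.Theorems

open MeasureTheory Set Literature.Probability.LatticeModels Literature.Probability.Percolation
open scoped Classical
open KNPreFKG

noncomputable section

namespace PocketCert

variable {V : Type*} [Fintype V]

/-- **(GΨ₃^D) from PCOV_x, PCOV_y and (Z*D), every monotone cluster property** (notation in the file header).
[cite: KozmaNitzan2024, Questions 8–9 (§5.5 p. 36), Conjecture 4 (p. 32)] -/
theorem gpsi_three_pocket_of_pcov (w : Sym2 V → unitInterval) (o x y z : V) (F : Set V → ℝ)
    (hFmono : ∀ S T : Set V, S ⊆ T → F S ≤ F T) (𝒟 : Set (Set V)) (h𝒟 : IsLowerSet 𝒟)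
    (hx𝒟 : ∀ W ∈ 𝒟, x ∉ W) (hy𝒟 : ∀ W ∈ 𝒟, y ∉ W) (hz𝒟 : ∀ W ∈ 𝒟, z ∉ W) (t lam mu : ℝ) (ht0 : 0 ≤ t) (ht1 : t ≤ 1)
    -- non-degeneracy of the pocket cells
    (hE1 : 0 < (prodBernoulli w).real ({ω : BondConfig V | openCluster ω o ∈ 𝒟} ∩
      ({ω | ¬ (openGraph ω).Reachable x y} ∩ {ω | ¬ (openGraph ω).Reachable x z})))
    (hE2 : 0 < (prodBernoulli w).real ({ω : BondConfig V | openCluster ω o ∈ 𝒟} ∩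
      ({ω | ¬ (openGraph ω).Reachable y x} ∩ {ω | ¬ (openGraph ω).Reachable y z})))
    -- the certificate point
    (ht : t * ((prodBernoulli w).real (openConn x o ∩ {ω | ¬ (openGraph ω).Reachable x y} ∩ {ω | ¬ (openGraph ω).Reachable x z}) *
          (prodBernoulli w).real ({ω : BondConfig V | openCluster ω o ∈ 𝒟} ∩
            ({ω | ¬ (openGraph ω).Reachable y x} ∩ {ω | ¬ (openGraph ω).Reachable y z})) +
        (prodBernoulli w).real (openConn y o ∩ {ω | ¬ (openGraph ω).Reachable y x} ∩ {ω | ¬ (openGraph ω).Reachable y z}) *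
          (prodBernoulli w).real ({ω : BondConfig V | openCluster ω o ∈ 𝒟} ∩
            ({ω | ¬ (openGraph ω).Reachable x y} ∩ {ω | ¬ (openGraph ω).Reachable x z}))) =
      (prodBernoulli w).real (openConn x o ∩ {ω | ¬ (openGraph ω).Reachable x y} ∩ {ω | ¬ (openGraph ω).Reachable x z}) *
        (prodBernoulli w).real ({ω : BondConfig V | openCluster ω o ∈ 𝒟} ∩
          ({ω | ¬ (openGraph ω).Reachable y x} ∩ {ω | ¬ (openGraph ω).Reachable y z})))
    (hlam : lam * (prodBernoulli w).real ({ω : BondConfig V | openCluster ω o ∈ 𝒟} ∩ {ω | ¬ (openGraph ω).Reachable x z}) =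
      (prodBernoulli w).real (openConn x o ∩ {ω | ¬ (openGraph ω).Reachable x y} ∩ {ω | ¬ (openGraph ω).Reachable x z}) +
        t * (prodBernoulli w).real (openConn x o ∩ openConn x y ∩ {ω | ¬ (openGraph ω).Reachable x z}))
    (hmu : mu * (prodBernoulli w).real ({ω : BondConfig V | openCluster ω o ∈ 𝒟} ∩ {ω | ¬ (openGraph ω).Reachable y z}) =
      (prodBernoulli w).real (openConn y o ∩ {ω | ¬ (openGraph ω).Reachable y x} ∩ {ω | ¬ (openGraph ω).Reachable y z}) +
        (1 - t) * (prodBernoulli w).real (openConn y o ∩ openConn y x ∩ {ω | ¬ (openGraph ω).Reachable y z}))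
    -- PCOV, x-side, at the monotone cluster property F
    (hPx : (prodBernoulli w).real (openConn y o ∩ {ω | ¬ (openGraph ω).Reachable y x} ∩ {ω | ¬ (openGraph ω).Reachable y z}) *
        ((prodBernoulli w).real ({ω : BondConfig V | openCluster ω o ∈ 𝒟} ∩
              ({ω | ¬ (openGraph ω).Reachable x y} ∩ {ω | ¬ (openGraph ω).Reachable x z})) *
            (∫ ω in {ω : BondConfig V | openCluster ω o ∈ 𝒟} ∩
              (openConn x y ∩ {ω | ¬ (openGraph ω).Reachable x z}), F (openCluster ω x) ∂(prodBernoulli w)) -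
          (prodBernoulli w).real ({ω : BondConfig V | openCluster ω o ∈ 𝒟} ∩
              (openConn x y ∩ {ω | ¬ (openGraph ω).Reachable x z})) *
            (∫ ω in {ω : BondConfig V | openCluster ω o ∈ 𝒟} ∩
              ({ω | ¬ (openGraph ω).Reachable x y} ∩ {ω | ¬ (openGraph ω).Reachable x z}), F (openCluster ω x) ∂(prodBernoulli w))) ≤
      (prodBernoulli w).real ({ω : BondConfig V | openCluster ω o ∈ 𝒟} ∩
          ({ω | ¬ (openGraph ω).Reachable y x} ∩ {ω | ¬ (openGraph ω).Reachable y z})) *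
        (((prodBernoulli w).real ({ω : BondConfig V | openCluster ω o ∈ 𝒟} ∩
                ({ω | ¬ (openGraph ω).Reachable x y} ∩ {ω | ¬ (openGraph ω).Reachable x z})) +
              (prodBernoulli w).real ({ω : BondConfig V | openCluster ω o ∈ 𝒟} ∩
                (openConn x y ∩ {ω | ¬ (openGraph ω).Reachable x z}))) *
            ((∫ ω in openConn x o ∩ {ω | ¬ (openGraph ω).Reachable x y} ∩ {ω | ¬ (openGraph ω).Reachable x z},
                F (openCluster ω x) ∂(prodBernoulli w)) +
              (∫ ω in openConn x o ∩ openConn x y ∩ {ω | ¬ (openGraph ω).Reachable x z}, F (openCluster ω x) ∂(prodBernoulli w))) -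
          ((prodBernoulli w).real (openConn x o ∩ {ω | ¬ (openGraph ω).Reachable x y} ∩ {ω | ¬ (openGraph ω).Reachable x z}) +
              (prodBernoulli w).real (openConn x o ∩ openConn x y ∩ {ω | ¬ (openGraph ω).Reachable x z})) *
            ((∫ ω in {ω : BondConfig V | openCluster ω o ∈ 𝒟} ∩
                ({ω | ¬ (openGraph ω).Reachable x y} ∩ {ω | ¬ (openGraph ω).Reachable x z}), F (openCluster ω x) ∂(prodBernoulli w)) +
              (∫ ω in {ω : BondConfig V | openCluster ω o ∈ 𝒟} ∩
                (openConn x y ∩ {ω | ¬ (openGraph ω).Reachable x z}), F (openCluster ω x) ∂(prodBernoulli w)))))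
    -- PCOV, y-side
    (hPy : (prodBernoulli w).real (openConn x o ∩ {ω | ¬ (openGraph ω).Reachable x y} ∩ {ω | ¬ (openGraph ω).Reachable x z}) *
        ((prodBernoulli w).real ({ω : BondConfig V | openCluster ω o ∈ 𝒟} ∩
              ({ω | ¬ (openGraph ω).Reachable y x} ∩ {ω | ¬ (openGraph ω).Reachable y z})) *
            (∫ ω in {ω : BondConfig V | openCluster ω o ∈ 𝒟} ∩
              (openConn y x ∩ {ω | ¬ (openGraph ω).Reachable y z}), F (openCluster ω y) ∂(prodBernoulli w)) -
          (prodBernoulli w).real ({ω : BondConfig V | openCluster ω o ∈ 𝒟} ∩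
              (openConn y x ∩ {ω | ¬ (openGraph ω).Reachable y z})) *
            (∫ ω in {ω : BondConfig V | openCluster ω o ∈ 𝒟} ∩
              ({ω | ¬ (openGraph ω).Reachable y x} ∩ {ω | ¬ (openGraph ω).Reachable y z}), F (openCluster ω y) ∂(prodBernoulli w))) ≤
      (prodBernoulli w).real ({ω : BondConfig V | openCluster ω o ∈ 𝒟} ∩
          ({ω | ¬ (openGraph ω).Reachable x y} ∩ {ω | ¬ (openGraph ω).Reachable x z})) *
        (((prodBernoulli w).real ({ω : BondConfig V | openCluster ω o ∈ 𝒟} ∩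
                ({ω | ¬ (openGraph ω).Reachable y x} ∩ {ω | ¬ (openGraph ω).Reachable y z})) +
              (prodBernoulli w).real ({ω : BondConfig V | openCluster ω o ∈ 𝒟} ∩
                (openConn y x ∩ {ω | ¬ (openGraph ω).Reachable y z}))) *
            ((∫ ω in openConn y o ∩ {ω | ¬ (openGraph ω).Reachable y x} ∩ {ω | ¬ (openGraph ω).Reachable y z},
                F (openCluster ω y) ∂(prodBernoulli w)) +
              (∫ ω in openConn y o ∩ openConn y x ∩ {ω | ¬ (openGraph ω).Reachable y z}, F (openCluster ω y) ∂(prodBernoulli w))) -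
          ((prodBernoulli w).real (openConn y o ∩ {ω | ¬ (openGraph ω).Reachable y x} ∩ {ω | ¬ (openGraph ω).Reachable y z}) +
              (prodBernoulli w).real (openConn y o ∩ openConn y x ∩ {ω | ¬ (openGraph ω).Reachable y z})) *
            ((∫ ω in {ω : BondConfig V | openCluster ω o ∈ 𝒟} ∩
                ({ω | ¬ (openGraph ω).Reachable y x} ∩ {ω | ¬ (openGraph ω).Reachable y z}), F (openCluster ω y) ∂(prodBernoulli w)) +
              (∫ ω in {ω : BondConfig V | openCluster ω o ∈ 𝒟} ∩
                (openConn y x ∩ {ω | ¬ (openGraph ω).Reachable y z}), F (openCluster ω y) ∂(prodBernoulli w)))))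
    -- the weak-relay part (Z*D)
    (hZ : (∫ ω in (openConn o x ∪ openConn o y) ∩ {ω | ¬ (openGraph ω).Reachable o z}, F (openCluster ω z) ∂(prodBernoulli w)) ≤
      lam * (∫ ω in {ω : BondConfig V | openCluster ω o ∈ 𝒟} ∩ {ω | ¬ (openGraph ω).Reachable x z}, F (openCluster ω z) ∂(prodBernoulli w)) +
        mu * (∫ ω in {ω : BondConfig V | openCluster ω o ∈ 𝒟} ∩ {ω | ¬ (openGraph ω).Reachable y z}, F (openCluster ω z) ∂(prodBernoulli w)))
    -- the pocket designation of `z`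
    (hzx : (∫ ω in {ω : BondConfig V | openCluster ω o ∈ 𝒟}, F (openCluster ω z) ∂(prodBernoulli w)) ≤
      (∫ ω in {ω : BondConfig V | openCluster ω o ∈ 𝒟}, F (openCluster ω x) ∂(prodBernoulli w)))
    (hzy : (∫ ω in {ω : BondConfig V | openCluster ω o ∈ 𝒟}, F (openCluster ω z) ∂(prodBernoulli w)) ≤
      (∫ ω in {ω : BondConfig V | openCluster ω o ∈ 𝒟}, F (openCluster ω y) ∂(prodBernoulli w))) :
    (∫ ω in (openConn o x ∪ openConn o y), F (openCluster ω z) ∂(prodBernoulli w)) ≤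
      (∫ ω in (openConn o x ∪ openConn o y), F (openCluster ω o) ∂(prodBernoulli w))   := by
  classical
  set μ := prodBernoulli w with hμ
  have hmeas : ∀ S : Set (BondConfig V), MeasurableSet S := fun _ => MeasurableSet.of_discrete
  have hint : ∀ (g : BondConfig V → ℝ) (S : Set (BondConfig V)), IntegrableOn g S μ :=
    fun g S => (Integrable.of_finite).integrableOn
  have hn := fun (S : Set (BondConfig V)) => (measureReal_nonneg : 0 ≤ μ.real S)
  set P : Set (BondConfig V) := {ω : BondConfig V | openCluster ω o ∈ 𝒟} with hP
  set E1x : Set (BondConfig V) := {ω : BondConfig V | ¬ (openGraph ω).Reachable x y} ∩ {ω | ¬ (openGraph ω).Reachable x z} with hE1x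
  set Fx : Set (BondConfig V) := openConn x y ∩ {ω : BondConfig V | ¬ (openGraph ω).Reachable x z} with hFx
  set E2y : Set (BondConfig V) := {ω : BondConfig V | ¬ (openGraph ω).Reachable y x} ∩ {ω | ¬ (openGraph ω).Reachable y z} with hE2y
  set Fy : Set (BondConfig V) := openConn y x ∩ {ω : BondConfig V | ¬ (openGraph ω).Reachable y z} with hFy
  set W1 : Set (BondConfig V) := openConn x o ∩ {ω | ¬ (openGraph ω).Reachable x y} ∩ {ω | ¬ (openGraph ω).Reachable x z} with hW1
  set W2 : Set (BondConfig V) := openConn y o ∩ {ω | ¬ (openGraph ω).Reachable y x} ∩ {ω | ¬ (openGraph ω).Reachable y z} with hW2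
  set W3x : Set (BondConfig V) := openConn x o ∩ openConn x y ∩ {ω | ¬ (openGraph ω).Reachable x z} with hW3x
  set W3y : Set (BondConfig V) := openConn y o ∩ openConn y x ∩ {ω | ¬ (openGraph ω).Reachable y z} with hW3y
  -- (BHK-D) for both owners
  have hBx := attach_of_pocket w o x y z 𝒟 h𝒟 hy𝒟 hz𝒟 F hFmono
  have hBy := attach_of_pocket w o y x z 𝒟 h𝒟 hx𝒟 hz𝒟 F hFmono
  -- the reference cells partition `P ∩ {x ↮ z}` resp. `P ∩ {y ↮ z}`
  have hdx : Disjoint (P ∩ E1x) (P ∩ Fx) := by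
    rw [Set.disjoint_left]
    rintro ω ⟨-, hxy, -⟩ ⟨-, hxy', -⟩
    exact hxy hxy'
  have hux : (P ∩ E1x) ∪ (P ∩ Fx) = P ∩ {ω | ¬ (openGraph ω).Reachable x z} := by
    ext ω
    simp only [hE1x, hFx, mem_inter_iff, mem_union, mem_setOf_eq, openConn]
    tauto
  have hdy : Disjoint (P ∩ E2y) (P ∩ Fy) := by
    rw [Set.disjoint_left]
    rintro ω ⟨-, hyx, -⟩ ⟨-, hyx', -⟩
    exact hyx hyx'
  have huy : (P ∩ E2y) ∪ (P ∩ Fy) = P ∩ {ω | ¬ (openGraph ω).Reachable y z} := by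
    ext ω
    simp only [hE2y, hFy, mem_inter_iff, mem_union, mem_setOf_eq, openConn]
    tauto
  have massx : μ.real (P ∩ {ω | ¬ (openGraph ω).Reachable x z}) = μ.real (P ∩ E1x) + μ.real (P ∩ Fx) := by
    rw [← hux, measureReal_union hdx (hmeas _)]
  have massy : μ.real (P ∩ {ω | ¬ (openGraph ω).Reachable y z}) = μ.real (P ∩ E2y) + μ.real (P ∩ Fy) := by
    rw [← huy, measureReal_union hdy (hmeas _)]
  have intx : ∀ v : V, ∫ ω in P ∩ {ω | ¬ (openGraph ω).Reachable x z}, F (openCluster ω v) ∂μ =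
      (∫ ω in P ∩ E1x, F (openCluster ω v) ∂μ) + ∫ ω in P ∩ Fx, F (openCluster ω v) ∂μ := by
    intro v; rw [← hux, setIntegral_union hdx (hmeas _) (hint _ _) (hint _ _)]
  have inty : ∀ v : V, ∫ ω in P ∩ {ω | ¬ (openGraph ω).Reachable y z}, F (openCluster ω v) ∂μ =
      (∫ ω in P ∩ E2y, F (openCluster ω v) ∂μ) + ∫ ω in P ∩ Fy, F (openCluster ω v) ∂μ := by
    intro v; rw [← huy, setIntegral_union hdy (hmeas _) (hint _ _) (hint _ _)]
  rw [massx] at hlam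
  rw [massy] at hmu
  have ht' : (1 - t) * (μ.real W2 * μ.real (P ∩ E1x) + μ.real W1 * μ.real (P ∩ E2y)) = μ.real W2 * μ.real (P ∩ E1x) := by
    linear_combination (-1 : ℝ) * ht
  have hP1x := p1star_pocket_of_pieces (∫ ω in W1, F (openCluster ω x) ∂μ) (∫ ω in W3x, F (openCluster ω x) ∂μ)
    (∫ ω in P ∩ E1x, F (openCluster ω x) ∂μ) (∫ ω in P ∩ Fx, F (openCluster ω x) ∂μ) (μ.real W1) (μ.real W3x) (μ.real W2)
    (μ.real (P ∩ E1x)) (μ.real (P ∩ Fx)) (μ.real (P ∩ E2y)) t lam ht0 ht1 hE1 hE2 (hn _) ht hlam hBx hPx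
  have hP1y := p1star_pocket_of_pieces (∫ ω in W2, F (openCluster ω y) ∂μ) (∫ ω in W3y, F (openCluster ω y) ∂μ)
    (∫ ω in P ∩ E2y, F (openCluster ω y) ∂μ) (∫ ω in P ∩ Fy, F (openCluster ω y) ∂μ) (μ.real W2) (μ.real W3y) (μ.real W1)
    (μ.real (P ∩ E2y)) (μ.real (P ∩ Fy)) (μ.real (P ∩ E1x)) (1 - t) mu (by linarith) (by linarith) hE2 hE1 (hn _) ht' hmu hBy hPy
  have hO' := opart_of_pocketHalves w o x y z F t (lam * ∫ ω in P ∩ {ω | ¬ (openGraph ω).Reachable x z}, F (openCluster ω x) ∂μ)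
    (mu * ∫ ω in P ∩ {ω | ¬ (openGraph ω).Reachable y z}, F (openCluster ω y) ∂μ)
    (by rw [intx]; exact hP1x) (by rw [inty]; exact hP1y)
  have hlam0 : 0 ≤ lam := by
    have hpos : 0 < μ.real (P ∩ E1x) + μ.real (P ∩ Fx) := by linarith [hn (P ∩ Fx)]
    have : 0 ≤ lam * (μ.real (P ∩ E1x) + μ.real (P ∩ Fx)) := by
      rw [hlam]; exact add_nonneg (hn _) (mul_nonneg ht0 (hn _))
    exact (mul_nonneg_iff_of_pos_right hpos).1 this
  have hmu0 : 0 ≤ mu := by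
    have hpos : 0 < μ.real (P ∩ E2y) + μ.real (P ∩ Fy) := by linarith [hn (P ∩ Fy)]
    have : 0 ≤ mu * (μ.real (P ∩ E2y) + μ.real (P ∩ Fy)) := by
      rw [hmu]; exact add_nonneg (hn _) (mul_nonneg (by linarith) (hn _))
    exact (mul_nonneg_iff_of_pos_right hpos).1 this
  exact gpsi_three_pocket_of_dom w o x y z F P lam mu hlam0 hmu0 hO' hZ hzx hzy

end PocketCert

end

end Summit.CriticalPhenomena.PercolationContinuityZ3.Theorems
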